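import Literature.NumberTheory.Automorphic.EichlerEmbeddingLocalLevel
import HarnessLib

/-!
# k3 · generation 9 sketch for `stub_takahashi` (crux `stmt-ABC-11338`, `DefiniteRTControlPrime`, route `DefiniteXi`)

FAMILY 3 (probe the extremes), two techniques deep, on the LAST un-decomposed local node of k3's Plan A:
**H6.A2** = Voight, *Quaternion algebras*, Lemma 30.6.3 (every optimal `A ∈ O` with characteristic polynomial
`f = X² - tX + n` is `O^×`-conjugate to a normalized matrix `N_x = (x 1; -f(x) t-x)` or to `ϖ⁻¹ N_x ϖ`), in the
matrix currency of gens 6–8 (`eichlerSet / IsOptimalMat / EichConj / normMat / varpi`, copied VERBATIM).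

* T1 **extremal configuration.**  Inside an `O^×`-class the `(0,1)` entry can be made a unit (⇒ normalized, by the
  diagonal witness `diag(1, b⁻¹)`, (30.6.5)) unless the class is *scalar mod q* — gen 8's conjugation invariant
  `IsScalarModQ`.  So L. 30.6.3 SHARPENS to a DICHOTOMY decided by that invariant: `¬ IsScalarModQ A ⇒ A ~ N_x`
  (cases "b unit" / "a-d unit", witnesses `diag(1,b⁻¹)` and the shear `(1 1; 0 1)`, (30.6.7)), and
  `IsScalarModQ A ⇒` optimality forces the EXTREME valuation `‖A 1 0‖ = q^{-e}` exactly ("c unit"), the Atkin–Lehner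
  move `ϖ` to the other end order makes `c` the `(0,1)` entry ((30.6.6)), and `A ~ ϖ⁻¹ N_{A 1 1} ϖ` is a NEW class
  (no normalized matrix in it, gen 8 H8.2'+H8.3).  The dichotomy is exactly the disjointness that Prop. 30.6.12's
  count (H6.A5) needs: classes = {normalized} ⊔ {scalar mod q}.
* T2 **degenerate parameters.**  `e = 0`: H6.A2 as typed (no `he`) stays TRUE — case "c unit" then means
  `‖A 1 0‖ = 1` and still yields the second disjunct (ϖ ∈ GL₂(ℤ_q) = O^× there); the case split below is ordered
  (b unit → c extreme → a-d unit) so that NO `1 ≤ e` is needed anywhere in H6.A2; only the "normalized" half of the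
  dichotomy carries `he : 1 ≤ e` (at `e = 0` optimal = not scalar mod q, gen 8 H8.0, so nothing is lost).
  Scalar `A` is excluded by `IsOptimalMat` (H9.0b), which is what pins `t = tr A`, `n = det A` from `hchar` (H9.0a);
  `q = 2` needs nothing special (no `2⁻¹` appears: the witnesses are `diag`, shear, `ϖ`).

RESULT: the whole file is KERNEL-CHECKED (rc 0, 0 sorries): primitives H9.0–H9.10 with EXPLICIT witnesses, the
three case lemmas, **H6.A2 = L. 30.6.3 in gen-6's signature verbatim**, the dichotomy, and — as by-products — gen 8's
H8.2/H8.2' (class-invariance of `IsScalarModQ`) and H8.9c (`EichConj.trans`).  Plan A's local normal-form layer is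
no longer a stub; what remains local is H6.A1 (dictionary typing), H6.A5 (the count over this dichotomy), H6.A6.
Sources: [corpus: paper:url-ec4e7f04c233 p.542–544 = Voight §30.6, L. 30.6.3 with (30.6.5)–(30.6.7), Def. 30.6.8,
Prop. 30.6.12] ← Hijikata 1974 Thm. 2.3; [corpus: book:bergeron2016-spectrum-hyperbolic-surfaces pp.211–213,
L. 8.9/8.10] (level `p` case).
-/

noncomputable section

open scoped Matrix
open Literature.NumberTheory.Automorphic

set_option linter.unusedVariables false
set_option linter.dupNamespace false

namespace Summit.ABC.ABC.Cruxes.DefiniteRTControlPrime.StubIdeas3g9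

/-! ## Definitions (verbatim from gens 6/8) + the two conjugation moves (30.6.6), (30.6.7) -/

section Defs

variable {q : ℕ} [hq : Fact q.Prime]

/-- The standard local Eichler order of level `q^e`, `(ℤ_q ℤ_q; q^e ℤ_q ℤ_q)`, as a set of matrices. -/
def eichlerSet (q : ℕ) [Fact q.Prime] (e : ℕ) : Set (Matrix (Fin 2) (Fin 2) ℚ_[q]) :=
  {A | (∀ i j, ‖A i j‖ ≤ 1) ∧ ‖A 1 0‖ ≤ (q : ℝ) ^ (-(e : ℤ))}

/-- `A ∈ O` generates an OPTIMALLY embedded order `ℤ_q[A]`: "at least one of `b`, `c/q^e`, `a - d` is a unit". -/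
def IsOptimalMat (q : ℕ) [Fact q.Prime] (e : ℕ) (A : Matrix (Fin 2) (Fin 2) ℚ_[q]) : Prop :=
  A ∈ eichlerSet q e ∧
    ¬ (‖A 0 1‖ < 1 ∧ ‖A 0 0 - A 1 1‖ < 1 ∧ ‖A 1 0‖ ≤ (q : ℝ) ^ (-((e + 1 : ℕ) : ℤ)))

/-- Conjugacy under the unit group of the standard Eichler order: `A' = μ⁻¹ A μ`, `μ ∈ O^×`. -/
def EichConj (q : ℕ) [Fact q.Prime] (e : ℕ) (A A' : Matrix (Fin 2) (Fin 2) ℚ_[q]) : Prop :=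
  ∃ μ : Matrix (Fin 2) (Fin 2) ℚ_[q], μ ∈ eichlerSet q e ∧ IsUnit μ.det ∧ μ⁻¹ ∈ eichlerSet q e ∧
    A' = μ⁻¹ * A * μ

/-- Voight's normalized matrix `N_x = (x 1; -f(x) t-x)`, `f = X² - tX + n` (Def. 30.6.8). -/
def normMat (t n x : ℚ_[q]) : Matrix (Fin 2) (Fin 2) ℚ_[q] := !![x, 1; -(x ^ 2 - t * x + n), t - x]

/-- The Atkin–Lehner element `ϖ = (0 1; q^e 0)` of the normalizer (30.6.1). -/
def varpi (q : ℕ) [Fact q.Prime] (e : ℕ) : Matrix (Fin 2) (Fin 2) ℚ_[q] := !![0, 1; (q : ℚ_[q]) ^ e, 0]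

/-- (gen 8) `A ≡ λ · 1 (mod q M₂(ℤ_q))`: the conjugation invariant separating the two kinds of classes. -/
def IsScalarModQ (A : Matrix (Fin 2) (Fin 2) ℚ_[q]) : Prop :=
  ‖A 0 1‖ < 1 ∧ ‖A 1 0‖ < 1 ∧ ‖A 0 0 - A 1 1‖ < 1

/-- NEW (30.6.6): `ϖ⁻¹ (a b; c d) ϖ = (d, c/q^e; b q^e, a)` — the Atkin–Lehner move SWAPS the roles of `b` and
`c/q^e` (and of `a`, `d`).  Also equals `ϖ A ϖ⁻¹` (`ϖ² = q^e · 1` is central, H9.4a). -/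
def varpiConjMat (q : ℕ) [Fact q.Prime] (e : ℕ) (A : Matrix (Fin 2) (Fin 2) ℚ_[q]) :
    Matrix (Fin 2) (Fin 2) ℚ_[q] :=
  !![A 1 1, A 1 0 / (q : ℚ_[q]) ^ e; A 0 1 * (q : ℚ_[q]) ^ e, A 0 0]

/-- NEW (30.6.7): `U⁻¹ (a b; c d) U = (a-c, (a-d)+b-c; c, c+d)` for the shear `U = (1 1; 0 1) ∈ O^×`. -/
def shearConj (A : Matrix (Fin 2) (Fin 2) ℚ_[q]) : Matrix (Fin 2) (Fin 2) ℚ_[q] :=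
  !![A 0 0 - A 1 0, A 0 0 - A 1 1 + A 0 1 - A 1 0; A 1 0, A 1 0 + A 1 1]

end Defs

section Entries

variable {q : ℕ} [hq : Fact q.Prime]

@[simp] theorem varpiConjMat_apply00 (e : ℕ) (A : Matrix (Fin 2) (Fin 2) ℚ_[q]) :
    varpiConjMat q e A 0 0 = A 1 1 := rfl
@[simp] theorem varpiConjMat_apply01 (e : ℕ) (A : Matrix (Fin 2) (Fin 2) ℚ_[q]) :
    varpiConjMat q e A 0 1 = A 1 0 / (q : ℚ_[q]) ^ e := rfl
@[simp] theorem varpiConjMat_apply10 (e : ℕ) (A : Matrix (Fin 2) (Fin 2) ℚ_[q]) :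
    varpiConjMat q e A 1 0 = A 0 1 * (q : ℚ_[q]) ^ e := rfl
@[simp] theorem varpiConjMat_apply11 (e : ℕ) (A : Matrix (Fin 2) (Fin 2) ℚ_[q]) :
    varpiConjMat q e A 1 1 = A 0 0 := rfl
@[simp] theorem shearConj_apply00 (A : Matrix (Fin 2) (Fin 2) ℚ_[q]) : shearConj A 0 0 = A 0 0 - A 1 0 := rfl
@[simp] theorem shearConj_apply01 (A : Matrix (Fin 2) (Fin 2) ℚ_[q]) :
    shearConj A 0 1 = A 0 0 - A 1 1 + A 0 1 - A 1 0 := rfl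
@[simp] theorem shearConj_apply10 (A : Matrix (Fin 2) (Fin 2) ℚ_[q]) : shearConj A 1 0 = A 1 0 := rfl
@[simp] theorem shearConj_apply11 (A : Matrix (Fin 2) (Fin 2) ℚ_[q]) : shearConj A 1 1 = A 1 0 + A 1 1 := rfl

end Entries

/-! ## Primitives H9.0–H9.10 (XS = a few lines, S = one short prover sitting); ALL PROVED -/

section Helpers

variable {q : ℕ} [hq : Fact q.Prime]

/-- H9.0a (S): for a NON-SCALAR matrix, `A² - tA + n = 0` pins `t = tr A` and `n = det A`
(entries `(0,1)`, `(1,0)`, `(0,0)-(1,1)` of the identity are `b(a+d-t)`, `c(a+d-t)`, `(a-d)(a+d-t)`). -/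
theorem trace_det_of_char {t n : ℚ_[q]} {A : Matrix (Fin 2) (Fin 2) ℚ_[q]}
    (hchar : A * A - t • A + n • (1 : Matrix (Fin 2) (Fin 2) ℚ_[q]) = 0)
    (hns : A 0 1 ≠ 0 ∨ A 1 0 ≠ 0 ∨ A 0 0 ≠ A 1 1) :
    A 0 0 + A 1 1 = t ∧ A 0 0 * A 1 1 - A 0 1 * A 1 0 = n := by
  have h00 := congrFun (congrFun hchar 0) 0
  have h01 := congrFun (congrFun hchar 0) 1
  have h10 := congrFun (congrFun hchar 1) 0
  have h11 := congrFun (congrFun hchar 1) 1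
  simp [Matrix.mul_apply, Fin.sum_univ_two] at h00 h01 h10 h11
  have ht : A 0 0 + A 1 1 = t := by
    rcases hns with hb | hc | had
    · exact mul_left_cancel₀ hb (by linear_combination h01)
    · exact mul_left_cancel₀ hc (by linear_combination h10)
    · exact mul_left_cancel₀ (sub_ne_zero.mpr had) (by linear_combination h00 - h11)
  exact ⟨ht, by linear_combination (A 0 0) * ht - h00⟩

/-- H9.0b (XS): an optimal matrix is not scalar (else `b = c = a - d = 0` have norm `0 < 1`). PROVED. -/
theorem nonscalar_of_isOptimalMat {e : ℕ} {A : Matrix (Fin 2) (Fin 2) ℚ_[q]} (hA : IsOptimalMat q e A) :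
    A 0 1 ≠ 0 ∨ A 1 0 ≠ 0 ∨ A 0 0 ≠ A 1 1 := by
  by_contra h
  push Not at h
  obtain ⟨hb, hc, had⟩ := h
  have hq0 : (0 : ℝ) < q := by exact_mod_cast hq.out.pos
  exact hA.2 ⟨by simp [hb], by simp [had], by simp [hc, (zpow_pos hq0 _).le]⟩

/-- H9.0c (XS): `f(a) = -bc` once `t = a + d`, `n = ad - bc`; hence `‖f(A 0 0)‖ ≤ q^{-e}` on `O`. PROVED. -/
theorem norm_f_apply00_le {e : ℕ} {t n : ℚ_[q]} {A : Matrix (Fin 2) (Fin 2) ℚ_[q]} (hA : A ∈ eichlerSet q e)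
    (ht : A 0 0 + A 1 1 = t) (hn : A 0 0 * A 1 1 - A 0 1 * A 1 0 = n) :
    ‖A 0 0 ^ 2 - t * A 0 0 + n‖ ≤ (q : ℝ) ^ (-(e : ℤ)) := by
  have hf : A 0 0 ^ 2 - t * A 0 0 + n = -(A 0 1 * A 1 0) := by
    rw [← ht, ← hn]; ring
  rw [hf, norm_neg, norm_mul]
  calc ‖A 0 1‖ * ‖A 1 0‖ ≤ 1 * (q : ℝ) ^ (-(e : ℤ)) :=
        mul_le_mul (hA.1 0 1) hA.2 (norm_nonneg _) zero_le_one
    _ = (q : ℝ) ^ (-(e : ℤ)) := one_mul _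

/-- H9.0d (XS): the symmetric statement for `A 1 1` (`f(d) = -bc` as well). PROVED. -/
theorem norm_f_apply11_le {e : ℕ} {t n : ℚ_[q]} {A : Matrix (Fin 2) (Fin 2) ℚ_[q]} (hA : A ∈ eichlerSet q e)
    (ht : A 0 0 + A 1 1 = t) (hn : A 0 0 * A 1 1 - A 0 1 * A 1 0 = n) :
    ‖A 1 1 ^ 2 - t * A 1 1 + n‖ ≤ (q : ℝ) ^ (-(e : ℤ)) := by
  have hf : A 1 1 ^ 2 - t * A 1 1 + n = -(A 0 1 * A 1 0) := by
    rw [← ht, ← hn]; ring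
  rw [hf, norm_neg, norm_mul]
  calc ‖A 0 1‖ * ‖A 1 0‖ ≤ 1 * (q : ℝ) ^ (-(e : ℤ)) :=
        mul_le_mul (hA.1 0 1) hA.2 (norm_nonneg _) zero_le_one
    _ = (q : ℝ) ^ (-(e : ℤ)) := one_mul _

/-- H9.0e (XS): a matrix in `O`... any matrix with `(0,1)` entry `1`, trace `t` and determinant `n` IS the
normalized matrix `N_{A 0 0}` (pure algebra). PROVED. -/
theorem eq_normMat_of_apply01_eq_one {t n : ℚ_[q]} {B : Matrix (Fin 2) (Fin 2) ℚ_[q]} (h01 : B 0 1 = 1)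
    (ht : B 0 0 + B 1 1 = t) (hn : B 0 0 * B 1 1 - B 0 1 * B 1 0 = n) : B = normMat t n (B 0 0) := by
  ext i j
  fin_cases i <;> fin_cases j
  · simp [normMat]
  · simp [normMat, h01]
  · simp [normMat]
    rw [← ht, ← hn, h01]; ring
  · simp [normMat]
    rw [← ht]; ring

/-- H9.1 (S) **(30.6.5), the diagonal witness**: if `b = A 0 1` is a unit then `A ~ N_{A 0 0}` via
`μ = diag(1, b⁻¹) ∈ O^×` (`μ⁻¹ = diag(1, b)`, `μ⁻¹ A μ = (a, 1; bc, d)`). PROVED. -/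
theorem eichConj_normMat_of_norm01_eq_one {e : ℕ} {t n : ℚ_[q]} {A : Matrix (Fin 2) (Fin 2) ℚ_[q]}
    (hA : A ∈ eichlerSet q e) (hb : ‖A 0 1‖ = 1) (ht : A 0 0 + A 1 1 = t)
    (hn : A 0 0 * A 1 1 - A 0 1 * A 1 0 = n) : EichConj q e A (normMat t n (A 0 0)) := by
  have hq0 : (0 : ℝ) < q := by exact_mod_cast hq.out.pos
  have hb0 : A 0 1 ≠ 0 := by
    intro h; rw [h, norm_zero] at hb; exact zero_ne_one hb
  have hinv : (!![1, 0; 0, (A 0 1)⁻¹] : Matrix (Fin 2) (Fin 2) ℚ_[q])⁻¹ = !![1, 0; 0, A 0 1] := by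
    refine Matrix.inv_eq_right_inv ?_
    ext i j
    simp only [Matrix.mul_apply, Fin.sum_univ_two]
    fin_cases i <;> fin_cases j <;> simp [hb0]
  refine ⟨!![1, 0; 0, (A 0 1)⁻¹], ⟨?_, ?_⟩, ?_, ?_, ?_⟩
  · intro i j
    fin_cases i <;> fin_cases j <;> simp [hb]
  · simp
  · rw [Matrix.det_fin_two_of]
    simp [hb0]
  · rw [hinv]
    refine ⟨?_, ?_⟩
    · intro i j
      fin_cases i <;> fin_cases j <;> simp [hb.le]
    · simp
  · rw [hinv]
    subst ht hn
    ext i j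
    simp only [Matrix.mul_apply, Fin.sum_univ_two]
    fin_cases i <;> fin_cases j <;> simp [normMat, hb0] <;> field_simp <;> ring

/-- H9.2 (S) **(30.6.6)**: `ϖ⁻¹ A ϖ = (d, c/q^e; b q^e, a)` (`ϖ⁻¹ = (0 q^{-e}; 1 0)` by `Matrix.inv_eq_right_inv`). PROVED. -/
theorem varpi_inv_mul_mul_varpi (e : ℕ) (A : Matrix (Fin 2) (Fin 2) ℚ_[q]) :
    (varpi q e)⁻¹ * A * varpi q e = varpiConjMat q e A := by
  have hπ : (q : ℚ_[q]) ^ e ≠ 0 := pow_ne_zero _ (Nat.cast_ne_zero.mpr hq.out.ne_zero)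
  have hinv : (varpi q e)⁻¹ = !![0, ((q : ℚ_[q]) ^ e)⁻¹; 1, 0] := by
    refine Matrix.inv_eq_right_inv ?_
    ext i j
    fin_cases i <;> fin_cases j <;> simp [varpi, Matrix.mul_apply, Fin.sum_univ_two, hπ]
  rw [hinv]
  ext i j
  simp only [Matrix.mul_apply, Fin.sum_univ_two]
  fin_cases i <;> fin_cases j
  · simp [varpi, varpiConjMat]
    linear_combination (A 1 1) * inv_mul_cancel₀ hπ
  · simp [varpi, varpiConjMat]
    ring
  · simp [varpi, varpiConjMat]
  · simp [varpi, varpiConjMat]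

/-- H9.3 (XS): the `ϖ`-move preserves `O` (`‖c/q^e‖ = ‖c‖ q^e ≤ 1`, `‖b q^e‖ ≤ q^{-e}`; `Padic.norm_p_pow`). PROVED. -/
theorem varpiConjMat_mem_eichlerSet {e : ℕ} {A : Matrix (Fin 2) (Fin 2) ℚ_[q]} (hA : A ∈ eichlerSet q e) :
    varpiConjMat q e A ∈ eichlerSet q e := by
  have hq0 : (0 : ℝ) < q := by exact_mod_cast hq.out.pos
  have hq1 : (1 : ℝ) ≤ q := by exact_mod_cast hq.out.one_lt.le
  have hπn : ‖(q : ℚ_[q]) ^ e‖ = (q : ℝ) ^ (-(e : ℤ)) := Padic.norm_p_pow e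
  have hze : (q : ℝ) ^ (-(e : ℤ)) ≤ 1 := zpow_le_one_of_nonpos₀ hq1 (by simp)
  have h00 : ‖varpiConjMat q e A 0 0‖ ≤ 1 := by rw [varpiConjMat_apply00]; exact hA.1 1 1
  have h01 : ‖varpiConjMat q e A 0 1‖ ≤ 1 := by
    rw [varpiConjMat_apply01, norm_div, hπn, div_le_one (zpow_pos hq0 _)]
    exact hA.2
  have h10 : ‖varpiConjMat q e A 1 0‖ ≤ (q : ℝ) ^ (-(e : ℤ)) := by
    rw [varpiConjMat_apply10, norm_mul, hπn]
    exact mul_le_of_le_one_left (zpow_nonneg hq0.le _) (hA.1 0 1)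
  have h11 : ‖varpiConjMat q e A 1 1‖ ≤ 1 := by rw [varpiConjMat_apply11]; exact hA.1 0 0
  refine ⟨?_, h10⟩
  intro i j
  fin_cases i <;> fin_cases j
  · exact h00
  · exact h01
  · exact h10.trans hze
  · exact h11

/-- H9.3' (XS): the `ϖ`-move turns an EXTREME `c` (`‖A 1 0‖ = q^{-e}`) into a unit `(0,1)` entry. PROVED. -/
theorem norm_varpiConjMat01_eq_one {e : ℕ} {A : Matrix (Fin 2) (Fin 2) ℚ_[q]}
    (hc : ‖A 1 0‖ = (q : ℝ) ^ (-(e : ℤ))) : ‖varpiConjMat q e A 0 1‖ = 1 := by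
  have hq0 : (0 : ℝ) < q := by exact_mod_cast hq.out.pos
  simp only [varpiConjMat, Matrix.of_apply, Matrix.cons_val', Matrix.cons_val_one, Matrix.cons_val_zero,
    Matrix.cons_val_fin_one, norm_div, Padic.norm_p_pow, hc]
  exact div_self (zpow_pos hq0 _).ne'

/-- H9.3'' (XS): the `ϖ`-move preserves trace and determinant (needs `q^e ≠ 0` in `ℚ_q`). PROVED. -/
theorem varpiConjMat_trace_det (e : ℕ) (A : Matrix (Fin 2) (Fin 2) ℚ_[q]) :
    varpiConjMat q e A 0 0 + varpiConjMat q e A 1 1 = A 0 0 + A 1 1 ∧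
      varpiConjMat q e A 0 0 * varpiConjMat q e A 1 1 - varpiConjMat q e A 0 1 * varpiConjMat q e A 1 0 =
        A 0 0 * A 1 1 - A 0 1 * A 1 0 := by
  have hπ : (q : ℚ_[q]) ^ e ≠ 0 := pow_ne_zero _ (Nat.cast_ne_zero.mpr hq.out.ne_zero)
  refine ⟨?_, ?_⟩
  · simp [varpiConjMat]; ring
  · simp [varpiConjMat]
    field_simp

/-- H9.4a (XS): the `ϖ`-move is an involution on matrices: `ϖ⁻¹ (ϖ⁻¹ A ϖ) ϖ = A` (`ϖ² = q^e · 1` central). PROVED. -/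
theorem varpiConjMat_varpiConjMat (e : ℕ) (A : Matrix (Fin 2) (Fin 2) ℚ_[q]) :
    varpiConjMat q e (varpiConjMat q e A) = A := by
  have hπ : (q : ℚ_[q]) ^ e ≠ 0 := pow_ne_zero _ (Nat.cast_ne_zero.mpr hq.out.ne_zero)
  ext i j
  fin_cases i <;> fin_cases j <;> simp [varpiConjMat, hπ]

/-- H9.4b (S) **transport**: `ϖ` normalizes `O`, so `O^×`-conjugacy is transported by the `ϖ`-move
(witness `ϖ⁻¹ μ ϖ = varpiConjMat μ ∈ O^×` by H9.3, `det` unchanged; products by H9.2). PROVED. -/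
theorem EichConj.map_varpi {e : ℕ} {A B : Matrix (Fin 2) (Fin 2) ℚ_[q]} (h : EichConj q e A B) :
    EichConj q e (varpiConjMat q e A) (varpiConjMat q e B) := by
  obtain ⟨μ, hμ, hdet, hμi, hB⟩ := h
  have hπ : (q : ℚ_[q]) ^ e ≠ 0 := pow_ne_zero _ (Nat.cast_ne_zero.mpr hq.out.ne_zero)
  have hϖdet : IsUnit (varpi q e).det := by
    rw [varpi, Matrix.det_fin_two_of]
    simp [hπ]
  have hϖ2 : (varpi q e)⁻¹ * varpi q e = 1 := Matrix.nonsing_inv_mul _ hϖdet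
  have hνeq : varpiConjMat q e μ = (varpi q e)⁻¹ * μ * varpi q e := (varpi_inv_mul_mul_varpi e μ).symm
  have hνinv : (varpiConjMat q e μ)⁻¹ = varpiConjMat q e μ⁻¹ := by
    refine Matrix.inv_eq_right_inv ?_
    rw [hνeq, ← varpi_inv_mul_mul_varpi e μ⁻¹]
    simp only [Matrix.mul_assoc]
    rw [Matrix.mul_nonsing_inv_cancel_left _ _ hϖdet, Matrix.mul_nonsing_inv_cancel_left _ _ hdet]
    exact hϖ2
  refine ⟨varpiConjMat q e μ, varpiConjMat_mem_eichlerSet hμ, ?_, ?_, ?_⟩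
  · have h2 := (varpiConjMat_trace_det e μ).2
    rw [Matrix.det_fin_two, h2, ← Matrix.det_fin_two]
    exact hdet
  · rw [hνinv]
    exact varpiConjMat_mem_eichlerSet hμi
  · rw [hνinv, hνeq, ← varpi_inv_mul_mul_varpi e μ⁻¹, ← varpi_inv_mul_mul_varpi e A,
      ← varpi_inv_mul_mul_varpi e B, hB]
    simp only [Matrix.mul_assoc]
    rw [Matrix.mul_nonsing_inv_cancel_left _ _ hϖdet, Matrix.mul_nonsing_inv_cancel_left _ _ hϖdet]

/-- H9.4c (XS from H9.4a/b): pulling a class back through the `ϖ`-move. PROVED. -/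
theorem EichConj.of_varpi {e : ℕ} {A B : Matrix (Fin 2) (Fin 2) ℚ_[q]} (h : EichConj q e (varpiConjMat q e A) B) :
    EichConj q e A (varpiConjMat q e B) := by
  have h' := h.map_varpi
  rwa [varpiConjMat_varpiConjMat] at h'

/-- H9.5 (S) **(30.6.7), the shear witness**: `A ~ U⁻¹ A U` for `U = (1 1; 0 1)` (`U, U⁻¹ = (1 -1; 0 1) ∈ O` for every
`e`, `det U = 1`). PROVED. -/
theorem eichConj_shearConj {e : ℕ} {A : Matrix (Fin 2) (Fin 2) ℚ_[q]} (hA : A ∈ eichlerSet q e) :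
    EichConj q e A (shearConj A) := by
  have hq0 : (0 : ℝ) < q := by exact_mod_cast hq.out.pos
  have hinv : (!![1, 1; 0, 1] : Matrix (Fin 2) (Fin 2) ℚ_[q])⁻¹ = !![1, -1; 0, 1] := by
    refine Matrix.inv_eq_right_inv ?_
    ext i j
    simp only [Matrix.mul_apply, Fin.sum_univ_two]
    fin_cases i <;> fin_cases j <;> simp
  refine ⟨!![1, 1; 0, 1], ⟨?_, ?_⟩, ?_, ?_, ?_⟩
  · intro i j
    fin_cases i <;> fin_cases j <;> simp
  · simp
  · rw [Matrix.det_fin_two_of]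
    simp
  · rw [hinv]
    refine ⟨?_, ?_⟩
    · intro i j
      fin_cases i <;> fin_cases j <;> simp
    · simp
  · rw [hinv]
    ext i j
    simp only [Matrix.mul_apply, Fin.sum_univ_two]
    fin_cases i <;> fin_cases j <;> simp <;> ring

/-- H9.5' (XS): the shear preserves `O` (ultrametric sums of integral entries, `(1,0)` entry unchanged). PROVED. -/
theorem shearConj_mem_eichlerSet {e : ℕ} {A : Matrix (Fin 2) (Fin 2) ℚ_[q]} (hA : A ∈ eichlerSet q e) :
    shearConj A ∈ eichlerSet q e := by
  have hq1 : (1 : ℝ) ≤ q := by exact_mod_cast hq.out.one_lt.le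
  have hze : (q : ℝ) ^ (-(e : ℤ)) ≤ 1 := zpow_le_one_of_nonpos₀ hq1 (by simp)
  have hc1 : ‖A 1 0‖ ≤ 1 := hA.2.trans hze
  have h00 : ‖shearConj A 0 0‖ ≤ 1 := by
    rw [shearConj_apply00]
    exact (Brandt.norm_sub_le_max _ _).trans (max_le (hA.1 0 0) hc1)
  have h01 : ‖shearConj A 0 1‖ ≤ 1 := by
    rw [shearConj_apply01]
    refine (Brandt.norm_sub_le_max _ _).trans (max_le ?_ hc1)
    refine (Padic.nonarchimedean _ _).trans (max_le ?_ (hA.1 0 1))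
    exact (Brandt.norm_sub_le_max _ _).trans (max_le (hA.1 0 0) (hA.1 1 1))
  have h10 : ‖shearConj A 1 0‖ ≤ (q : ℝ) ^ (-(e : ℤ)) := by rw [shearConj_apply10]; exact hA.2
  have h11 : ‖shearConj A 1 1‖ ≤ 1 := by
    rw [shearConj_apply11]
    exact (Padic.nonarchimedean _ _).trans (max_le hc1 (hA.1 1 1))
  refine ⟨?_, h10⟩
  intro i j
  fin_cases i <;> fin_cases j
  · exact h00
  · exact h01
  · exact hc1
  · exact h11

/-- H9.5'' (XS): trace/det of the shear conjugate. PROVED. -/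
theorem shearConj_trace_det (A : Matrix (Fin 2) (Fin 2) ℚ_[q]) :
    shearConj A 0 0 + shearConj A 1 1 = A 0 0 + A 1 1 ∧
      shearConj A 0 0 * shearConj A 1 1 - shearConj A 0 1 * shearConj A 1 0 = A 0 0 * A 1 1 - A 0 1 * A 1 0 := by
  refine ⟨?_, ?_⟩ <;> simp [shearConj] <;> ring

/-- H9.6 (XS) **unit + small = unit**: in case "a-d unit, b and c small" the shear's `(0,1)` entry `(a-d)+b-c` is a
unit (`Padic.add_eq_max_of_ne`). PROVED. -/
theorem norm_shear01_eq_one {A : Matrix (Fin 2) (Fin 2) ℚ_[q]} (hb : ‖A 0 1‖ < 1) (hc : ‖A 1 0‖ < 1)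
    (had : ‖A 0 0 - A 1 1‖ = 1) : ‖A 0 0 - A 1 1 + A 0 1 - A 1 0‖ = 1 := by
  have hsmall : ‖A 0 1 - A 1 0‖ < 1 := lt_of_le_of_lt (Brandt.norm_sub_le_max _ _) (max_lt hb hc)
  have hsplit : A 0 0 - A 1 1 + A 0 1 - A 1 0 = (A 0 0 - A 1 1) + (A 0 1 - A 1 0) := by ring
  have hne : ‖A 0 0 - A 1 1‖ ≠ ‖A 0 1 - A 1 0‖ := by rw [had]; exact (ne_of_lt hsmall).symm
  rw [hsplit, Padic.add_eq_max_of_ne hne, had]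
  exact max_eq_left hsmall.le

/-- H9.7 (XS) **the extreme valuation**: on `O`, "`c/q^e` is a unit" = `¬ ‖A 1 0‖ ≤ q^{-(e+1)}` = `‖A 1 0‖ = q^{-e}`
(norms are powers of `q`: `Padic.norm_le_pow_iff_norm_lt_pow_add_one`, as in gen 8's H6.A4 assembly). PROVED. -/
theorem norm10_eq_of_not_le {e : ℕ} {A : Matrix (Fin 2) (Fin 2) ℚ_[q]} (hA : A ∈ eichlerSet q e)
    (hc : ¬ ‖A 1 0‖ ≤ (q : ℝ) ^ (-((e + 1 : ℕ) : ℤ))) : ‖A 1 0‖ = (q : ℝ) ^ (-(e : ℤ)) := by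
  refine le_antisymm hA.2 ?_
  have h := not_lt.mp ((Padic.norm_le_pow_iff_norm_lt_pow_add_one (A 1 0) (-((e + 1 : ℕ) : ℤ))).not.mp hc)
  have he1 : (-((e + 1 : ℕ) : ℤ)) + 1 = -(e : ℤ) := by omega
  rw [he1] at h
  exact h

/-- H9.8a (XS): `O` is closed under multiplication (`(MN)₁₀ = M₁₀ N₀₀ + M₁₁ N₁₀`, ultrametric). PROVED. -/
theorem eichlerSet_mul_mem {e : ℕ} {M N : Matrix (Fin 2) (Fin 2) ℚ_[q]} (hM : M ∈ eichlerSet q e)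
    (hN : N ∈ eichlerSet q e) : M * N ∈ eichlerSet q e := by
  have hq0 : (0 : ℝ) < q := by exact_mod_cast hq.out.pos
  have entry : ∀ i j, (M * N) i j = M i 0 * N 0 j + M i 1 * N 1 j := fun i j => by
    simp [Matrix.mul_apply, Fin.sum_univ_two]
  refine ⟨fun i j => ?_, ?_⟩
  · rw [entry]
    refine (Padic.nonarchimedean _ _).trans (max_le ?_ ?_)
    · rw [norm_mul]; exact mul_le_one₀ (hM.1 i 0) (norm_nonneg _) (hN.1 0 j)
    · rw [norm_mul]; exact mul_le_one₀ (hM.1 i 1) (norm_nonneg _) (hN.1 1 j)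
  · rw [entry]
    refine (Padic.nonarchimedean _ _).trans (max_le ?_ ?_)
    · rw [norm_mul]
      calc ‖M 1 0‖ * ‖N 0 0‖ ≤ (q : ℝ) ^ (-(e : ℤ)) * 1 :=
            mul_le_mul hM.2 (hN.1 0 0) (norm_nonneg _) (zpow_nonneg hq0.le _)
        _ = (q : ℝ) ^ (-(e : ℤ)) := mul_one _
    · rw [norm_mul]
      calc ‖M 1 1‖ * ‖N 1 0‖ ≤ 1 * (q : ℝ) ^ (-(e : ℤ)) :=
            mul_le_mul (hM.1 1 1) hN.2 (norm_nonneg _) zero_le_one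
        _ = (q : ℝ) ^ (-(e : ℤ)) := one_mul _

/-- H9.8 (S) = gen 8 H8.9c (NOT new): `EichConj` is transitive (`μ = μ₁ μ₂`, `Matrix.mul_inv_rev`). PROVED. -/
theorem EichConj.trans {e : ℕ} {A A' A'' : Matrix (Fin 2) (Fin 2) ℚ_[q]} (h : EichConj q e A A')
    (h' : EichConj q e A' A'') : EichConj q e A A'' := by
  obtain ⟨μ₁, h1, d1, i1, e1⟩ := h
  obtain ⟨μ₂, h2, d2, i2, e2⟩ := h'
  refine ⟨μ₁ * μ₂, eichlerSet_mul_mem h1 h2, ?_, ?_, ?_⟩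
  · rw [Matrix.det_mul]; exact d1.mul d2
  · rw [Matrix.mul_inv_rev]; exact eichlerSet_mul_mem i2 i1
  · rw [e2, e1, Matrix.mul_inv_rev]
    simp only [Matrix.mul_assoc]

/-- H9.9a (XS): every entry of `P X M` is `< 1` in norm when `P`, `M` are integral and `X` has all entries `< 1`
(strict ultrametric inequality, four-term sums). PROVED. -/
theorem norm_conj_entry_lt_one {P X M : Matrix (Fin 2) (Fin 2) ℚ_[q]} (hP : ∀ i j, ‖P i j‖ ≤ 1)
    (hM : ∀ i j, ‖M i j‖ ≤ 1) (hX : ∀ i j, ‖X i j‖ < 1) (i j : Fin 2) : ‖(P * X * M) i j‖ < 1 := by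
  have hadd : ∀ x y : ℚ_[q], ‖x‖ < 1 → ‖y‖ < 1 → ‖x + y‖ < 1 := fun x y hx hy =>
    lt_of_le_of_lt (Padic.nonarchimedean _ _) (max_lt hx hy)
  have hmulL : ∀ p x : ℚ_[q], ‖p‖ ≤ 1 → ‖x‖ < 1 → ‖p * x‖ < 1 := fun p x hp hx => by
    rw [norm_mul]
    calc ‖p‖ * ‖x‖ ≤ 1 * ‖x‖ := mul_le_mul_of_nonneg_right hp (norm_nonneg _)
      _ < 1 := by rw [one_mul]; exact hx
  have hmulR : ∀ x m : ℚ_[q], ‖x‖ < 1 → ‖m‖ ≤ 1 → ‖x * m‖ < 1 := fun x m hx hm => by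
    rw [mul_comm]; exact hmulL m x hm hx
  have entry : (P * X * M) i j =
      (P i 0 * X 0 0 + P i 1 * X 1 0) * M 0 j + (P i 0 * X 0 1 + P i 1 * X 1 1) * M 1 j := by
    simp [Matrix.mul_apply, Fin.sum_univ_two]
  rw [entry]
  exact hadd _ _
    (hmulR _ _ (hadd _ _ (hmulL _ _ (hP i 0) (hX 0 0)) (hmulL _ _ (hP i 1) (hX 1 0))) (hM 0 j))
    (hmulR _ _ (hadd _ _ (hmulL _ _ (hP i 0) (hX 0 1)) (hmulL _ _ (hP i 1) (hX 1 1))) (hM 1 j))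

/-- H9.9b (S) = gen 8 H8.2 (NOT new): conjugation by `μ` with `μ`, `μ⁻¹` integral preserves "scalar mod `q`"
(`A = a·1 + X`, all entries of `X` of norm `< 1`, `μ⁻¹ A μ = a·1 + μ⁻¹ X μ`). PROVED. -/
theorem isScalarModQ_conj {A μ : Matrix (Fin 2) (Fin 2) ℚ_[q]} (hμ : ∀ i j, ‖μ i j‖ ≤ 1)
    (hμi : ∀ i j, ‖μ⁻¹ i j‖ ≤ 1) (hdet : IsUnit μ.det) (h : IsScalarModQ A) :
    IsScalarModQ (μ⁻¹ * A * μ) := by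
  set X : Matrix (Fin 2) (Fin 2) ℚ_[q] := A - A 0 0 • (1 : Matrix (Fin 2) (Fin 2) ℚ_[q]) with hXdef
  have hXlt : ∀ i j, ‖X i j‖ < 1 := by
    have h00 : ‖X 0 0‖ < 1 := by simp [hXdef]
    have h01 : ‖X 0 1‖ < 1 := by simpa [hXdef] using h.1
    have h10 : ‖X 1 0‖ < 1 := by simpa [hXdef] using h.2.1
    have h11 : ‖X 1 1‖ < 1 := by
      have : X 1 1 = -(A 0 0 - A 1 1) := by simp [hXdef]
      rw [this, norm_neg]; exact h.2.2
    intro i j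
    fin_cases i <;> fin_cases j
    · exact h00
    · exact h01
    · exact h10
    · exact h11
  have hdecomp : μ⁻¹ * A * μ = A 0 0 • (1 : Matrix (Fin 2) (Fin 2) ℚ_[q]) + μ⁻¹ * X * μ := by
    have hA : A = A 0 0 • (1 : Matrix (Fin 2) (Fin 2) ℚ_[q]) + X := by rw [hXdef]; abel
    conv_lhs => rw [hA]
    rw [Matrix.mul_add, Matrix.add_mul, Matrix.mul_smul, Matrix.mul_one, Matrix.smul_mul,
      Matrix.nonsing_inv_mul _ hdet]
  have hY := norm_conj_entry_lt_one hμi hμ hXlt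
  rw [hdecomp]
  refine ⟨?_, ?_, ?_⟩
  · simpa [Matrix.add_apply, Matrix.smul_apply] using hY 0 1
  · simpa [Matrix.add_apply, Matrix.smul_apply] using hY 1 0
  · have hdiff : (A 0 0 • (1 : Matrix (Fin 2) (Fin 2) ℚ_[q]) + μ⁻¹ * X * μ) 0 0 -
        (A 0 0 • (1 : Matrix (Fin 2) (Fin 2) ℚ_[q]) + μ⁻¹ * X * μ) 1 1 =
        (μ⁻¹ * X * μ) 0 0 - (μ⁻¹ * X * μ) 1 1 := by
      simp [Matrix.add_apply, Matrix.smul_apply]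
    rw [hdiff]
    exact lt_of_le_of_lt (Brandt.norm_sub_le_max _ _) (max_lt (hY 0 0) (hY 1 1))

/-- H9.9 (S) = gen 8 H8.2' (NOT new): `IsScalarModQ` is constant on `EichConj` classes. PROVED. -/
theorem isScalarModQ_iff_of_eichConj {e : ℕ} {A A' : Matrix (Fin 2) (Fin 2) ℚ_[q]} (h : EichConj q e A A') :
    IsScalarModQ A ↔ IsScalarModQ A' := by
  obtain ⟨μ, hμ, hdet, hμi, rfl⟩ := h
  constructor
  · exact isScalarModQ_conj hμ.1 hμi.1 hdet
  · intro h'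
    have hμ' : ∀ i j, ‖μ⁻¹⁻¹ i j‖ ≤ 1 := by
      rw [Matrix.nonsing_inv_nonsing_inv _ hdet]; exact hμ.1
    have key := isScalarModQ_conj hμi.1 hμ' (Matrix.isUnit_nonsing_inv_det _ hdet) h'
    rw [Matrix.nonsing_inv_nonsing_inv _ hdet] at key
    have hsimp : μ * (μ⁻¹ * A * μ) * μ⁻¹ = A := by
      simp only [Matrix.mul_assoc]
      rw [Matrix.mul_nonsing_inv_cancel_left _ _ hdet, Matrix.mul_nonsing_inv _ hdet, Matrix.mul_one]
    rwa [hsimp] at key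

/-- H9.10 (XS) = gen 8 H8.3 (NOT new): a normalized matrix is never scalar mod `q`. PROVED. -/
theorem not_isScalarModQ_normMat (t n x : ℚ_[q]) : ¬ IsScalarModQ (normMat t n x) := by
  intro h
  have h1 := h.1
  simp [normMat] at h1

end Helpers

/-! ## The three cases of L. 30.6.3 (PROVED) -/

section Cases

variable {q : ℕ} [hq : Fact q.Prime]

/-- Case "b unit" (XS from H9.1 + H9.0c): `x = a`. PROVED. -/
theorem case_b {e : ℕ} {t n : ℚ_[q]} {A : Matrix (Fin 2) (Fin 2) ℚ_[q]} (hA : A ∈ eichlerSet q e)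
    (hb : ‖A 0 1‖ = 1) (ht : A 0 0 + A 1 1 = t) (hn : A 0 0 * A 1 1 - A 0 1 * A 1 0 = n) :
    ∃ x : ℚ_[q], ‖x‖ ≤ 1 ∧ ‖x ^ 2 - t * x + n‖ ≤ (q : ℝ) ^ (-(e : ℤ)) ∧ EichConj q e A (normMat t n x) :=
  ⟨A 0 0, hA.1 0 0, norm_f_apply00_le hA ht hn, eichConj_normMat_of_norm01_eq_one hA hb ht hn⟩

/-- Case "a-d unit, b and c small" (S from H9.5/5'/5''/6 + case b + H9.8): shear first, `x = a - c`. PROVED. -/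
theorem case_ad {e : ℕ} {t n : ℚ_[q]} {A : Matrix (Fin 2) (Fin 2) ℚ_[q]} (hA : A ∈ eichlerSet q e)
    (hb : ‖A 0 1‖ < 1) (hc : ‖A 1 0‖ < 1) (had : ‖A 0 0 - A 1 1‖ = 1) (ht : A 0 0 + A 1 1 = t)
    (hn : A 0 0 * A 1 1 - A 0 1 * A 1 0 = n) :
    ∃ x : ℚ_[q], ‖x‖ ≤ 1 ∧ ‖x ^ 2 - t * x + n‖ ≤ (q : ℝ) ^ (-(e : ℤ)) ∧ EichConj q e A (normMat t n x) := by
  have hB : shearConj A ∈ eichlerSet q e := shearConj_mem_eichlerSet hA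
  have hB01 : ‖shearConj A 0 1‖ = 1 := by
    simpa [shearConj] using norm_shear01_eq_one hb hc had
  obtain ⟨htr, hdet⟩ := shearConj_trace_det A
  obtain ⟨x, hx, hfx, hconj⟩ := case_b hB hB01 (htr.trans ht) (hdet.trans hn)
  exact ⟨x, hx, hfx, (eichConj_shearConj hA).trans hconj⟩

/-- Case "c extreme" (S from H9.2/3/3'/3''/4c + case b): move to the other end with `ϖ`, `x = d`.  Yields the SECOND
disjunct of H6.A2, for every `e` (also `e = 0`). PROVED. -/
theorem case_c {e : ℕ} {t n : ℚ_[q]} {A : Matrix (Fin 2) (Fin 2) ℚ_[q]} (hA : A ∈ eichlerSet q e)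
    (hc : ‖A 1 0‖ = (q : ℝ) ^ (-(e : ℤ))) (ht : A 0 0 + A 1 1 = t) (hn : A 0 0 * A 1 1 - A 0 1 * A 1 0 = n) :
    ∃ x : ℚ_[q], ‖x‖ ≤ 1 ∧ ‖x ^ 2 - t * x + n‖ ≤ (q : ℝ) ^ (-(e : ℤ)) ∧
      EichConj q e A ((varpi q e)⁻¹ * normMat t n x * varpi q e) := by
  have hB : varpiConjMat q e A ∈ eichlerSet q e := varpiConjMat_mem_eichlerSet hA
  have hB01 : ‖varpiConjMat q e A 0 1‖ = 1 := norm_varpiConjMat01_eq_one hc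
  obtain ⟨htr, hdet⟩ := varpiConjMat_trace_det e A
  obtain ⟨x, hx, hfx, hconj⟩ := case_b hB hB01 (htr.trans ht) (hdet.trans hn)
  refine ⟨x, hx, hfx, ?_⟩
  rw [varpi_inv_mul_mul_varpi]
  exact EichConj.of_varpi hconj

end Cases

/-! ## Assemblies: H6.A2 (gen-6 signature VERBATIM) and the T1 dichotomy — PROVED (0 sorries) -/

section Assembly

variable {q : ℕ} [hq : Fact q.Prime]

/-- **H6.A2** [Voight L. 30.6.3], gen-6 signature verbatim (no `1 ≤ e` needed).  PROVED (kernel-checked, no sorry):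
case split ordered `b` unit → `c` extreme → (`a-d` unit forced by optimality, with `b`, `c` small). -/
theorem eichConj_normMat_or_varpi (e : ℕ) {t n : ℚ_[q]} {A : Matrix (Fin 2) (Fin 2) ℚ_[q]}
    (hA : IsOptimalMat q e A)
    (hchar : A * A - t • A + n • (1 : Matrix (Fin 2) (Fin 2) ℚ_[q]) = 0) :
    ∃ x : ℚ_[q], ‖x‖ ≤ 1 ∧ ‖x ^ 2 - t * x + n‖ ≤ (q : ℝ) ^ (-(e : ℤ)) ∧
      (EichConj q e A (normMat t n x) ∨
        EichConj q e A ((varpi q e)⁻¹ * normMat t n x * varpi q e)) := by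
  have hq1 : (1 : ℝ) < q := by exact_mod_cast hq.out.one_lt
  obtain ⟨ht, hn⟩ := trace_det_of_char hchar (nonscalar_of_isOptimalMat hA)
  by_cases h1 : ‖A 0 1‖ = 1
  · obtain ⟨x, hx, hfx, h⟩ := case_b hA.1 h1 ht hn
    exact ⟨x, hx, hfx, Or.inl h⟩
  by_cases h2 : ‖A 1 0‖ ≤ (q : ℝ) ^ (-((e + 1 : ℕ) : ℤ))
  · -- `b` not a unit, `c/q^e` not a unit ⇒ optimality forces `a - d` a unit
    have hb : ‖A 0 1‖ < 1 := lt_of_le_of_ne (hA.1.1 0 1) h1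
    have hc : ‖A 1 0‖ < 1 := lt_of_le_of_lt h2 (zpow_lt_one_of_neg₀ hq1 (by omega))
    have had1 : ‖A 0 0 - A 1 1‖ ≤ 1 := (Brandt.norm_sub_le_max _ _).trans (max_le (hA.1.1 0 0) (hA.1.1 1 1))
    have had : ‖A 0 0 - A 1 1‖ = 1 := by
      by_contra h
      exact hA.2 ⟨hb, lt_of_le_of_ne had1 h, h2⟩
    obtain ⟨x, hx, hfx, h⟩ := case_ad hA.1 hb hc had ht hn
    exact ⟨x, hx, hfx, Or.inl h⟩
  · obtain ⟨x, hx, hfx, h⟩ := case_c hA.1 (norm10_eq_of_not_le hA.1 h2) ht hn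
    exact ⟨x, hx, hfx, Or.inr h⟩

/-- **T1 dichotomy, normalized half** (NEW sharpening of L. 30.6.3): for `e ≥ 1`, an optimal `A` that is NOT scalar
mod `q` is conjugate to a normalized matrix.  PROVED. -/
theorem exists_eichConj_normMat_of_not_isScalarModQ {e : ℕ} (he : 1 ≤ e) {t n : ℚ_[q]}
    {A : Matrix (Fin 2) (Fin 2) ℚ_[q]} (hA : IsOptimalMat q e A)
    (hchar : A * A - t • A + n • (1 : Matrix (Fin 2) (Fin 2) ℚ_[q]) = 0) (hns : ¬ IsScalarModQ A) :
    ∃ x : ℚ_[q], ‖x‖ ≤ 1 ∧ ‖x ^ 2 - t * x + n‖ ≤ (q : ℝ) ^ (-(e : ℤ)) ∧ EichConj q e A (normMat t n x) := by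
  have hq1 : (1 : ℝ) < q := by exact_mod_cast hq.out.one_lt
  obtain ⟨ht, hn⟩ := trace_det_of_char hchar (nonscalar_of_isOptimalMat hA)
  have hc : ‖A 1 0‖ < 1 := lt_of_le_of_lt hA.1.2 (zpow_lt_one_of_neg₀ hq1 (by omega))
  by_cases h1 : ‖A 0 1‖ = 1
  · exact case_b hA.1 h1 ht hn
  · have hb : ‖A 0 1‖ < 1 := lt_of_le_of_ne (hA.1.1 0 1) h1
    have had1 : ‖A 0 0 - A 1 1‖ ≤ 1 := (Brandt.norm_sub_le_max _ _).trans (max_le (hA.1.1 0 0) (hA.1.1 1 1))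
    have had : ‖A 0 0 - A 1 1‖ = 1 := by
      by_contra h
      exact hns ⟨hb, hc, lt_of_le_of_ne had1 h⟩
    exact case_ad hA.1 hb hc had ht hn

/-- **T1 dichotomy, new-class half** (NEW): an optimal `A` that IS scalar mod `q` has the EXTREME valuation
`‖A 1 0‖ = q^{-e}`, is conjugate to `ϖ⁻¹ N_d ϖ` with `q ∣ t - 2d`, `q^{e+1} ∣ f(d)` (a "new" class in the sense of
L. 30.6.9 (c)), and to NO normalized matrix.  PROVED (last conjunct = gen 8 H8.2' + H8.3, proved here too). -/
theorem exists_eichConj_varpi_of_isScalarModQ {e : ℕ} {t n : ℚ_[q]} {A : Matrix (Fin 2) (Fin 2) ℚ_[q]}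
    (hA : IsOptimalMat q e A) (hchar : A * A - t • A + n • (1 : Matrix (Fin 2) (Fin 2) ℚ_[q]) = 0)
    (hs : IsScalarModQ A) :
    ‖A 1 0‖ = (q : ℝ) ^ (-(e : ℤ)) ∧
      (∃ x : ℚ_[q], ‖x‖ ≤ 1 ∧ ‖x ^ 2 - t * x + n‖ ≤ (q : ℝ) ^ (-((e + 1 : ℕ) : ℤ)) ∧ ‖t - 2 * x‖ < 1 ∧
        EichConj q e A ((varpi q e)⁻¹ * normMat t n x * varpi q e)) ∧
      ∀ x' : ℚ_[q], ¬ EichConj q e A (normMat t n x') := by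
  have hq0 : (0 : ℝ) < q := by exact_mod_cast hq.out.pos
  obtain ⟨ht, hn⟩ := trace_det_of_char hchar (nonscalar_of_isOptimalMat hA)
  have h2 : ¬ ‖A 1 0‖ ≤ (q : ℝ) ^ (-((e + 1 : ℕ) : ℤ)) := fun h => hA.2 ⟨hs.1, hs.2.2, h⟩
  have hc : ‖A 1 0‖ = (q : ℝ) ^ (-(e : ℤ)) := norm10_eq_of_not_le hA.1 h2
  refine ⟨hc, ?_, fun x' h => not_isScalarModQ_normMat t n x' ((isScalarModQ_iff_of_eichConj h).1 hs)⟩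
  -- the witness is `x = d = A 1 1`, exactly as in `case_c`
  have hB : varpiConjMat q e A ∈ eichlerSet q e := varpiConjMat_mem_eichlerSet hA.1
  have hB01 : ‖varpiConjMat q e A 0 1‖ = 1 := norm_varpiConjMat01_eq_one hc
  obtain ⟨htr, hdet⟩ := varpiConjMat_trace_det e A
  have hconj := eichConj_normMat_of_norm01_eq_one hB hB01 (htr.trans ht) (hdet.trans hn)
  have hB00 : varpiConjMat q e A 0 0 = A 1 1 := by simp [varpiConjMat]
  rw [hB00] at hconj
  refine ⟨A 1 1, hA.1.1 1 1, ?_, ?_, ?_⟩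
  · -- `f(d) = -bc` with `‖b‖ < 1` i.e. `‖b‖ ≤ q⁻¹` and `‖c‖ = q^{-e}`
    have hf : A 1 1 ^ 2 - t * A 1 1 + n = -(A 0 1 * A 1 0) := by rw [← ht, ← hn]; ring
    have hb : ‖A 0 1‖ ≤ (q : ℝ)⁻¹ := (Brandt.norm_lt_one_iff_le_inv _).1 hs.1
    rw [hf, norm_neg, norm_mul, hc]
    calc ‖A 0 1‖ * (q : ℝ) ^ (-(e : ℤ)) ≤ (q : ℝ)⁻¹ * (q : ℝ) ^ (-(e : ℤ)) :=
          mul_le_mul_of_nonneg_right hb (zpow_nonneg hq0.le _)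
      _ = (q : ℝ) ^ (-((e + 1 : ℕ) : ℤ)) := by
          rw [← zpow_neg_one, ← zpow_add₀ hq0.ne']
          congr 1
          push_cast
          ring
  · have hsplit : t - 2 * A 1 1 = A 0 0 - A 1 1 := by rw [← ht]; ring
    rw [hsplit]
    exact hs.2.2
  · rw [varpi_inv_mul_mul_varpi]
    exact EichConj.of_varpi hconj

end Assembly

/-! ## T2 kernel shadows (PROVED): the three witnesses over `ℤ`, and the `e = 0` reading -/

/-- (30.6.5) at `A = (2 3; 5 7)` (`b = 3` a unit away from 3): `diag(1,3) · A · diag(1, 3⁻¹)`, cleared of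
denominators: `diag(1,3) A = N · diag(1,3)`-shape identity `(1 0; 0 3)(2 3; 5 7) = (2 1; 15 7)(1 0; 0 3)`. PROVED. -/
example : !![(1 : ℤ), 0; 0, 3] * !![2, 3; 5, 7] = !![2, 1; 15, 7] * !![(1 : ℤ), 0; 0, 3] := by decide

/-- (30.6.6) at `q^e = 4`, `A = (a b; 4c d) = (2 3; 20 7)`: `A ϖ = ϖ (d c; 4b a)`, i.e.
`(2 3; 20 7)(0 1; 4 0) = (0 1; 4 0)(7 5; 12 2)`. PROVED. -/
example : !![(2 : ℤ), 3; 20, 7] * !![0, 1; 4, 0] = !![(0 : ℤ), 1; 4, 0] * !![7, 5; 12, 2] := by decide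

/-- (30.6.7) at `A = (2 3; 20 7)`: `A U = U (a-c', (a-d)+b-c'; c', c'+d)` with `U = (1 1; 0 1)`, `c' = 20`:
`(2 3; 20 7)(1 1; 0 1) = (1 1; 0 1)(-18 -22; 20 27)`. PROVED. -/
example : !![(2 : ℤ), 3; 20, 7] * !![1, 1; 0, 1] = !![(1 : ℤ), 1; 0, 1] * !![-18, -22; 20, 27] := by decide

/-- `e = 0` reading (T2): `ϖ = (0 1; 1 0)` has determinant `-1`, a unit, so at level `q^0` the second disjunct of
H6.A2 is also an `O^×`-conjugate of a normalized matrix — H6.A2 needs no `1 ≤ e`. PROVED. -/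
example : Matrix.det !![(0 : ℤ), 1; 1, 0] = -1 := by decide

end Summit.ABC.ABC.Cruxes.DefiniteRTControlPrime.StubIdeas3g9
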